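import Literature.Probability.RandomPlanarGeometry.ProfileCollar
import HarnessLib

/-!
# Collar domains with a bundled profile (helper file 1 for `stub_collarDomains`)

Route `CardyComplexCone`, crux `SLESixFamiliesGiveCardy`, line `collar-touch-sandwich`, STUB E
(`CollarDomains`).  The comparison rectangles of STUB E are collar domains of a Jordan domain `D` cut
out in the tubular coordinates `T.tube` (`ConformalTube.lean`) along a continuous `1`-periodic profile
`p` with `1 - h ≤ p ≤ 1 + h`, `0 < h ≤ 1/2`.  This file bundles such a profile as `Profile`, names the
loop `profileLoop T p t = T.tube (p t) t` and the Jordan domain `profileDomain T P` it bounds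
(`JordanDomain.ofLoop`), and specialises the general-profile collar API of
`Literature/Probability/RandomPlanarGeometry/ProfileCollar.lean` (stated there for any Jordan domain
whose frontier is the trace of the loop) to `profileDomain T P`: the ray through `∂D(t)` meets the loop
only at the profile value, the centre and the tube points below the profile are inside, tube points
above it are outside, `D` is inside when `p ≥ 1` (`carrier_subset_profileDomain`), and every point of
the CLOSED collar domain off `closure D` is a shallow exterior tube point `tube s t`, `1 < s ≤ p t`
(`exists_eq_tube_of_mem_closure`).

Source: B. Bollobás, O. Riordan, *Percolation* (2006), Ch. 7 p. 186 (the domains of Fig. 14).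
-/

noncomputable section

open Set Metric Topology Filter Bornology
open Literature.Probability.RandomPlanarGeometry

namespace Summit.CriticalPhenomena.CardyFormulaZ2.Cruxes.SLESixFamiliesGiveCardy.CollarTouchSandwich

/-- **Admissible profile**: a continuous `1`-periodic function `p` with `1 - h ≤ p ≤ 1 + h` for a
width `0 < h ≤ 1/2` (bundled as data: the function, the width and the four properties). -/
structure Profile where
  /-- The profile function. -/
  p : ℝ → ℝ
  /-- The width. -/
  h : ℝ
  /-- The profile is continuous. -/
  continuous : Continuous p
  /-- The profile is `1`-periodic. -/
  periodic : Function.Periodic p 1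
  /-- The width is positive. -/
  pos : 0 < h
  /-- The width is at most `1/2`. -/
  le_half : h ≤ 1 / 2
  /-- Lower bound `1 - h ≤ p`. -/
  lower : ∀ t, 1 - h ≤ p t
  /-- Upper bound `p ≤ 1 + h`. -/
  upper : ∀ t, p t ≤ 1 + h

namespace Profile

variable (P : Profile)

/-- The profile is positive. -/
theorem pos_apply (t : ℝ) : 0 < P.p t := by have := P.lower t; have := P.le_half; linarith

/-- The profile is below `2` (indeed `≤ 3/2`). -/
theorem lt_two (t : ℝ) : P.p t < 2 := by have := P.upper t; have := P.le_half; linarith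

end Profile

variable {D : JordanDomain} (T : D.TubeData)

/-! ### The loop and the domain -/

/-- **The profile loop** `t ↦ tube (p t) t`. -/
def profileLoop (p : ℝ → ℝ) (t : ℝ) : ℂ := T.tube (p t) t

/-- The profile loop is the loop of `ProfileCollar.lean`. -/
theorem profileLoop_eq (p : ℝ → ℝ) : profileLoop T p = fun u => T.tube (p u) u := rfl

variable (P : Profile)

/-- The profile loop is continuous. -/
theorem continuous_profileLoop : Continuous (profileLoop T P.p) :=
  T.continuous_profileLoop P.continuous P.pos_apply P.lt_two

/-- The profile loop is `1`-periodic. -/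
theorem periodic_profileLoop : Function.Periodic (profileLoop T P.p) 1 :=
  T.periodic_profileLoop P.periodic

/-- The profile loop is injective on a period. -/
theorem injOn_profileLoop : InjOn (profileLoop T P.p) (Ico 0 1) :=
  T.injOn_profileLoop P.pos_apply P.lt_two

/-- **The profile collar domain** bounded by the profile loop (`JordanDomain.ofLoop`). -/
def profileDomain : JordanDomain :=
  JordanDomain.ofLoop (continuous_profileLoop T P) (periodic_profileLoop T P) (injOn_profileLoop T P)

/-- The boundary of the profile collar domain is the profile loop. -/
@[simp] theorem profileDomain_boundary (t : ℝ) : (profileDomain T P).boundary t = T.tube (P.p t) t := rfl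

/-- The frontier of the profile collar domain is the trace of the profile loop. -/
theorem frontier_profileDomain : frontier (profileDomain T P).carrier = range (profileLoop T P.p) :=
  (profileDomain T P).range_boundary.symm

/-- The frontier of the profile collar domain, in the form used by `ProfileCollar.lean`. -/
theorem frontier_profileDomain' : frontier (profileDomain T P).carrier = range fun u => T.tube (P.p u) u :=
  (profileDomain T P).range_boundary.symm

/-! ### The ray through `∂D(t)` meets the loop once -/

/-- **A tube point `tube s t` (`0 ≤ s < 2`) lies on the profile loop iff `s = P.p t`.** -/
theorem tube_mem_range_profileLoop_iff {s : ℝ} (hs0 : 0 ≤ s) (hs2 : s < 2) (t : ℝ) :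
    T.tube s t ∈ range (profileLoop T P.p) ↔ s = P.p t :=
  T.tube_mem_range_profileLoop_iff P.periodic P.pos_apply P.lt_two hs0 hs2 t

/-- The boundary point `∂D(t)` lies on the profile loop iff `p t = 1`. -/
theorem boundary_mem_frontier_profileDomain_iff (t : ℝ) :
    D.boundary t ∈ frontier (profileDomain T P).carrier ↔ P.p t = 1 := by
  rw [frontier_profileDomain, ← T.tube_one t, tube_mem_range_profileLoop_iff T P zero_le_one one_lt_two, eq_comm]

/-! ### Inside and outside along the rays -/

/-- **Tube points above the profile are outside**: `tube s t ∉ collar` for `p t < s < 2`. -/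
theorem tube_not_mem_profileDomain {s t : ℝ} (hs : P.p t < s) (hs2 : s < 2) :
    T.tube s t ∉ (profileDomain T P).carrier :=
  T.tube_not_mem_of_frontier_eq P.periodic P.pos_apply P.lt_two _ (frontier_profileDomain' T P) hs hs2

variable (hclose : ∀ t, dist (profileLoop T P.p t) (D.boundary t) < infDist T.z₀ (frontier D.carrier))
include hclose

/-- **The centre lies inside the profile collar domain** when the loop is closer to `∂D` than the
depth of the centre (dog-on-leash). -/
theorem z₀_mem_profileDomain : T.z₀ ∈ (profileDomain T P).carrier :=
  T.z₀_mem_of_frontier_eq P.continuous P.periodic P.pos_apply P.lt_two _ (frontier_profileDomain' T P) hclose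

/-- **Tube points below the profile are inside**: `tube s t ∈ collar` for `0 ≤ s < p t`. -/
theorem tube_mem_profileDomain {s t : ℝ} (hs0 : 0 ≤ s) (hs : s < P.p t) :
    T.tube s t ∈ (profileDomain T P).carrier :=
  T.tube_mem_of_frontier_eq P.periodic P.pos_apply P.lt_two _ (frontier_profileDomain' T P)
    (z₀_mem_profileDomain T P hclose) hs0 hs

/-- **`D` lies inside the profile collar domain when the profile is at least `1`.** -/
theorem carrier_subset_profileDomain (hp1 : ∀ t, 1 ≤ P.p t) : D.carrier ⊆ (profileDomain T P).carrier := by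
  intro z hz
  obtain ⟨u, hu, rfl⟩ := T.Ci.bijOn_ball.surjOn hz
  have hu1 : ‖u‖ < 1 := mem_ball_zero_iff.1 hu
  rcases eq_or_ne u 0 with rfl | hu0
  · rw [T.Ci_zero]; exact z₀_mem_profileDomain T P hclose
  have hn : 0 < ‖u‖ := norm_pos_iff.2 hu0
  set v : ℂ := ((‖u‖⁻¹ : ℝ) : ℂ) * u with hv
  have hv1 : ‖v‖ = 1 := by
    rw [hv, norm_mul, Complex.norm_real, Real.norm_eq_abs, abs_of_pos (inv_pos.2 hn), inv_mul_cancel₀ hn.ne']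
  obtain ⟨t, ht⟩ : ∃ t, T.Ci.β t = v := by
    have hfr : T.Ci.Φ v ∈ frontier D.carrier := T.Ci.apply_mem_frontier hv1
    rw [← D.range_boundary] at hfr
    obtain ⟨t, ht⟩ := hfr
    refine ⟨t, ?_⟩
    have h1 : T.Ci.Φ (T.Ci.β t) = T.Ci.Φ v := by rw [T.Ci.apply_β]; exact ht
    exact T.Ci.injOn (mem_closedBall_zero_iff.2 (T.Ci.norm_β t).le) (mem_closedBall_zero_iff.2 hv1.le) h1
  have hu' : u = ((‖u‖ : ℝ) : ℂ) * T.Ci.β t := by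
    rw [ht, hv, ← mul_assoc, ← Complex.ofReal_mul, mul_inv_cancel₀ hn.ne', Complex.ofReal_one, one_mul]
  have hzt : T.Ci.Φ u = T.tube ‖u‖ t := by rw [T.tube_of_le_one hu1.le, ← hu']
  rw [hzt]
  exact tube_mem_profileDomain T P hclose hn.le (hu1.trans_le (hp1 t))

omit hclose in
/-- **Points of the closed collar domain outside `closure D` are shallow exterior tube points**:
such a point is `tube s t` with `1 < s ≤ p t` and `t ∈ [0, 1)`; if the point is in the (open)
collar domain then moreover `s < p t`. -/
theorem exists_eq_tube_of_mem_closure {z : ℂ} (hz : z ∈ closure (profileDomain T P).carrier)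
    (hzΩ : z ∉ closure D.carrier) : ∃ s t, 1 < s ∧ s ≤ P.p t ∧ t ∈ Ico (0 : ℝ) 1 ∧ z = T.tube s t ∧
      (z ∈ (profileDomain T P).carrier → s < P.p t) := by
  have hw : invMap T.z₀ z ∈ (D.inverted T.hz₀).carrier := D.invMap_mem_inverted T.hz₀ hzΩ
  obtain ⟨u, hu, hwu⟩ := T.Ce.bijOn_ball.surjOn hw
  have hu1 : ‖u‖ < 1 := mem_ball_zero_iff.1 hu
  have hu0 : u ≠ 0 := by
    rintro rfl
    rw [T.Ce_zero] at hwu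
    exact (invMap_eq_zero_iff.1 hwu.symm ▸ hzΩ) (subset_closure T.hz₀)
  have hn : 0 < ‖u‖ := norm_pos_iff.2 hu0
  set v : ℂ := ((‖u‖⁻¹ : ℝ) : ℂ) * u with hv
  have hv1 : ‖v‖ = 1 := by
    rw [hv, norm_mul, Complex.norm_real, Real.norm_eq_abs, abs_of_pos (inv_pos.2 hn), inv_mul_cancel₀ hn.ne']
  obtain ⟨t₁, ht₁⟩ : ∃ t, T.Ce.β t = v := by
    have hfr : T.Ce.Φ v ∈ frontier (D.inverted T.hz₀).carrier := T.Ce.apply_mem_frontier hv1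
    rw [← (D.inverted T.hz₀).range_boundary] at hfr
    obtain ⟨t, ht⟩ := hfr
    refine ⟨t, ?_⟩
    have h1 : T.Ce.Φ (T.Ce.β t) = T.Ce.Φ v := by rw [T.Ce.apply_β]; exact ht
    exact T.Ce.injOn (mem_closedBall_zero_iff.2 (T.Ce.norm_β t).le) (mem_closedBall_zero_iff.2 hv1.le) h1
  -- normalise the parameter into `[0, 1)`
  set t := Int.fract t₁ with ht_def
  have ht : T.Ce.β t = v := by rw [← ht₁, ht_def]; exact apply_fract_of_periodic T.Ce.periodic_β t₁
  have hu' : u = ((‖u‖ : ℝ) : ℂ) * T.Ce.β t := by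
    rw [ht, hv, ← mul_assoc, ← Complex.ofReal_mul, mul_inv_cancel₀ hn.ne', Complex.ofReal_one, one_mul]
  have hzt : z = T.tube (2 - ‖u‖) t := by
    rw [T.tube_of_one_lt (by linarith), show (2 - (2 - ‖u‖) : ℝ) = ‖u‖ by ring, ← hu', hwu, invMapInv_invMap]
  have hnot : ¬ P.p t < 2 - ‖u‖ := fun hlt => by
    have hout := tube_not_mem_profileDomain T P hlt (by linarith)
    rw [← hzt] at hout
    rw [closure_eq_self_union_frontier] at hz
    rcases hz with hz | hz
    · exact hout hz
    · rw [frontier_profileDomain T P, hzt, tube_mem_range_profileLoop_iff T P (by linarith) (by linarith)] at hz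
      linarith
  refine ⟨2 - ‖u‖, t, by linarith, not_lt.1 hnot, ⟨Int.fract_nonneg _, Int.fract_lt_one _⟩, hzt, fun hzin => ?_⟩
  rcases (not_lt.1 hnot).eq_or_lt with he | hlt
  · exfalso
    have hfr : z ∈ frontier (profileDomain T P).carrier := by
      rw [frontier_profileDomain T P, hzt, tube_mem_range_profileLoop_iff T P (by linarith) (by linarith)]
      exact he
    exact Set.disjoint_left.1 (profileDomain T P).disjoint_carrier_frontier hzin hfr
  · exact hlt

omit T P hclose in
/-- **Main statement of this file** (registered helper stub, arrow style): `D` lies inside the profile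
collar domain when the profile is at least `1` and the loop is closer to `∂D` than the depth of the centre. -/
theorem profileDomain_carrier_subset : ∀ {D : JordanDomain} (T : D.TubeData) (P : Profile), (∀ t, dist (profileLoop T P.p t) (D.boundary t) < infDist T.z₀ (frontier D.carrier)) → (∀ t, 1 ≤ P.p t) → D.carrier ⊆ (profileDomain T P).carrier :=
  fun T P hclose hp1 => carrier_subset_profileDomain T P hclose hp1

end Summit.CriticalPhenomena.CardyFormulaZ2.Cruxes.SLESixFamiliesGiveCardy.CollarTouchSandwich

end
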